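import Summits.QuantumFields.BalabanUV.Beta.NVertexColumnK1Row

/-!
# `BalabanUV.Beta.NVertexColumnK1RowPeriodised` — row D1 ∕ (C1) OWNER an2 (gen 63), PART 23: **THE (K1) ROW FOR THE COMPOSITE ONE-SHOT COLUMN, PERIODISED IN THE
# FINE BOND — THE END WRAPPER's (K1) RIGHT-SIDE SHAPE**: the Hessian image of the composite column IS minus `(Lc⁴)^{j+1}` times the multiplier response transported
# through ALL `j+1` bricks (`E″ colN = −(Lc⁴)^{j+1}·λ′ᴿ_{j+1}`), and its period sum over a fine torus `T″ = Lc·T′` is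
# `−(Lc⁴)^{j+1}·Σ_{κ₁} Σ'_{s₁} (Σ'_n λ′ᴿ_j (κ₁, s₁ + T′•n))·symLinKerAt (toSite R.r) Lc κ₁ s₁ (κ, s)` — the slot-PERIODISED weight against the brick over all slots,
# i.e. the wrapper's `w·Σ_ā hb ā·Σ_μ Σ'_y (Σ'_m cf … μ (translate (Ma (n+1)) y m) ā)·symLinKerAt ρ_c Lc μ y u` with `λ := λ′ᴿ_j` (PART 22 + PART 18's periodised ladder)

HONEST FRAMING (cell charter, verbatim): «discharging `BetaPertH` makes Bałaban's UV stability UNCONDITIONAL — a real constructive-QFT result; it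
is NOT the continuum limit and NOT the Clay problem.»  THIS MODULE DISCHARGES NOTHING of `BetaPertH` ∕ row D1 and NOT the END wrapper's (K1): its LEFT side there is
the road's torus letter `c·(perF T (bhKStepAt 3 ρH Lc 0))|ff *ᵥ hb (n+1) v` on the road's column `hv(dv)` (SPEC-51 §D; `perF_comp` bookkeeping + the exact part,
the road's); here only the row's side is periodised.  [folklore] bookkeeping BY NAME over the row's OWN objects: PART 22 `NVertexColumnK1Row.K1_row_composite_column_sym`,
PART 18 `NVertexLamWeightLadder.lamR_succ ∕ periodised_lamR_succ ∕ periodised_lamR_succ_tower`, PART 16's tower-torus letter `towerTorus_fine_apply_eq`.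
0 `def`, 0 `def … : Prop`, 0 sorry, nothing cited; no table VALUE, no estimate.  NOT (C1), NOT the wrapper's (K1), NOT D1, NEVER «G-an2-4 closed», NOT BetaPertH,
NOT continuum, NOT Clay.

WHAT (all [folklore]; `L = Lc^(j+1)`, `R : Roots Lc`, `j : ℕ`, source label `(μ, y)`, `colN := colH (AN R j) L μ y`,
`λ′ᴿ_m (κ,s) := Σ_ν Σ'_w Λ′_N μ y ν w·compLinKer (fun _ => symLinKerAt (toSite R.r) Lc) Lc m (κ,s) (ν,w)` as in PARTs 15–22):
* §1 **`curvAdj_curv_colH_AN_eq_neg_lamR_succ`**: `(E″ colN)(f) = −(Lc⁴)^{j+1}·λ′ᴿ_{j+1} (f)` (the response transported through all `j+1` bricks of the blocking `L`).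
* §2 **`tsum_curvAdj_curv_colH_AN_translate`**: for tori `T″ i = Lc·T′ i`, `1 ≤ T′ i`:
  `Σ'_n (E″ colN)(κ, translate T″ s n) = −(Lc⁴)^{j+1}·Σ_{κ₁} Σ'_{s₁} (Σ'_n λ′ᴿ_j (κ₁, translate T′ s₁ n))·symLinKerAt (toSite R.r) Lc κ₁ s₁ (κ, s)`;
  **`tsum_curvAdj_curv_colH_AN_translate_tower`**: the same on the tower tori `T″ := towerTorus Lc (fine Lc M) m′`, `T′ := towerTorus Lc M m′` (the wrapper's finest torus
  and its `Ma`, J-NOTE-1: `m′ = j = n+1`, `M = Mc B`).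
READING (zero weight): with J-NOTE-1's instantiation `cf (n+1) :=` the slot-transported straight coefficients, the right side above IS the wrapper's (K1) right side for the
direction `colN` up to the road's scalars `w (n+1)` and the leg-free `hbtop`; the left side is the fine-bond periodisation of `E″ colN`, which the road's `(perF T Ê)|ff *ᵥ colN̂`
equals by `perF_comp`-type bookkeeping (its (α)); the exact part `tgrad·λ̂θ` of `hv(dv)` drops from both sides (#21 `a0`, O-2).

HONEST DEPENDENCY (verbatim): «continuum YM on T⁴ ⇐ BetaPertH ∧ nine spine estimates (0/9 proved); BetaPertH ⇐ (D1) ∧ (D4) ∧ CAP+tail;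
G-an2-4 gates asym, D1 and NE2/3/4.»  ABSOLUTE RULE (cell, verbatim): «No internally-minted statement may enter as a cited fact. Every
hypothesis is either kernel-proved in this package or a verbatim quotation of a PUBLISHED theorem with page reference.»
Unit `b2b-balaban-beta-an2` gen 63 (row-D1 owner), 2026-08-27; `bears_on: R4-O/T1|T1a` (a (C1)-side identity behind the displayed row (K1); moves no node counter).
No existing file touched.
-/

noncomputable section

open scoped BigOperators

namespace Summit.QuantumFields.BalabanUV.Beta.NVertexColumnK1RowPeriodised

open Literature.MathematicalPhysics.QuantumFieldTheory
open Literature.MathematicalPhysics.QuantumFieldTheory.Balaban1983to89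
open Literature.MathematicalPhysics.QuantumFieldTheory.Balaban1983to89.Beta
open B4TorusKernel.MultiPeriod (translate)
open B5Prop11Plancherel (fine)
open AffineAveraging (Site toSite curv curvAdj)
open AveragingHessianKernels (Bond)
open OneStepResolventKernel (Fib KInv)
open OneStepKernelFamily (colH)
open BalabanStepJets (lamCoeffOf)
open Summit.QuantumFields.BalabanUV.Beta.AxialDressingRooted (one_le_of_neZero)
open Summit.QuantumFields.BalabanUV.Beta.SymAveragingHessianCounts (symLinKerAt)
open Summit.QuantumFields.BalabanUV.Beta.CompositeVertexKernelRec (compLinKer)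
open Summit.QuantumFields.BalabanUV.Beta.CompositeOneShotJetData (Roots AN)
open Summit.QuantumFields.BalabanUV.Beta.FP.TorusCompositeObjects (towerTorus)
open Summit.QuantumFields.BalabanUV.Beta.NVertexLamCorePeriodised (towerTorus_fine_apply_eq)
open Summit.QuantumFields.BalabanUV.Beta.NVertexLamWeightLadder (lamR_succ periodised_lamR_succ)
open Summit.QuantumFields.BalabanUV.Beta.NVertexColumnK1Row (K1_row_composite_column_sym)

variable {Lc : ℕ} [NeZero Lc] (R : Roots Lc) (j : ℕ)

/-! ## §1 The Hessian image of the composite column is the fully transported response -/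

/-- [folklore] **`curvAdj_curv_colH_AN_eq_neg_lamR_succ` — `E″ colN = −(Lc⁴)^{j+1}·λ′ᴿ_{j+1}`**: for every fine bond `f`,
`(E″(1) (colH (AN R j) L μ y)) f = −(Lc⁴)^{j+1}·Σ_ν Σ'_w Λ′_N μ y ν w·compLinKer (fun _ => symLinKerAt (toSite R.r) Lc) Lc (j+1) f (ν,w)` — PART 22's (K1) with PART 18's
ladder `lamR_succ` read backwards: the Hessian image of the composite one-shot column is the multiplier response transported through ALL `j+1` bricks of its blocking. -/
theorem curvAdj_curv_colH_AN_eq_neg_lamR_succ (μ : Fin (3 + 1)) (y : Site (3 + 1)) (f : Bond (3 + 1)) :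
    curvAdj (curv (colH (AN R j) (Lc ^ (j + 1)) μ y)) f.1 f.2
      = -((Lc : ℝ) ^ (3 + 1)) ^ (j + 1) * ∑ ν : Fin (3 + 1), ∑' w : Site (3 + 1),
          (∑ κ' : Fin (3 + 1), ∑' u : Site (3 + 1),
              AN R j u (((Lc ^ (j + 1) : ℕ) : ℤ) • y) (Sum.inl κ') (Sum.inr μ) * lamCoeffOf (KInv (N := Lc ^ (j + 1)) (d := 3)) (Lc ^ (j + 1)) ν w κ' u)
            * compLinKer (fun _ => symLinKerAt (toSite R.r) Lc) Lc (j + 1) f (ν, w) := by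
  rw [K1_row_composite_column_sym, show f = (f.1, f.2) from rfl, lamR_succ R j j μ f.1 y f.2]

/-! ## §2 Periodised in the fine bond: the wrapper's (K1) right-side shape -/

/-- [folklore] **`tsum_curvAdj_curv_colH_AN_translate` — THE PERIODISED (K1) ROW OF THE COMPOSITE COLUMN**: for fine∕slot tori `T″ i = Lc·T′ i` (`1 ≤ T′ i`) and every
fine bond `(κ, s)`,
`Σ'_n (E″(1) colN)(κ, translate T″ s n) = −(Lc⁴)^{j+1}·Σ_{κ₁} Σ'_{s₁} (Σ'_n λ′ᴿ_j (κ₁, translate T′ s₁ n))·symLinKerAt (toSite R.r) Lc κ₁ s₁ (κ, s)` — the SLOT-PERIODISED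
transported weight against the (0.4)-sym brick, summed over all slots: the END wrapper's (K1) right-side shape (§1, `tsum_mul_left`, PART 18 `periodised_lamR_succ`). -/
theorem tsum_curvAdj_curv_colH_AN_translate (T' T'' : Fin (3 + 1) → ℕ) (hT : ∀ i, T'' i = Lc * T' i) (hT' : ∀ i, 1 ≤ T' i)
    (μ κ : Fin (3 + 1)) (y s : Site (3 + 1)) :
    (∑' n : Site (3 + 1), curvAdj (curv (colH (AN R j) (Lc ^ (j + 1)) μ y)) κ (translate T'' s n))
      = -((Lc : ℝ) ^ (3 + 1)) ^ (j + 1) * ∑ κ₁ : Fin (3 + 1), ∑' s₁ : Site (3 + 1),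
          (∑' n : Site (3 + 1), ∑ ν : Fin (3 + 1), ∑' w : Site (3 + 1),
              (∑ κ' : Fin (3 + 1), ∑' u : Site (3 + 1),
                  AN R j u (((Lc ^ (j + 1) : ℕ) : ℤ) • y) (Sum.inl κ') (Sum.inr μ) * lamCoeffOf (KInv (N := Lc ^ (j + 1)) (d := 3)) (Lc ^ (j + 1)) ν w κ' u)
                * compLinKer (fun _ => symLinKerAt (toSite R.r) Lc) Lc j (κ₁, translate T' s₁ n) (ν, w))
            * symLinKerAt (toSite R.r) Lc κ₁ s₁ (κ, s) := by
  rw [← periodised_lamR_succ R j T' T'' hT hT' j μ κ y s, ← tsum_mul_left]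
  exact tsum_congr fun n => curvAdj_curv_colH_AN_eq_neg_lamR_succ R j μ y (κ, translate T'' s n)

/-- [folklore] **`tsum_curvAdj_curv_colH_AN_translate_tower`** — the same on the tower tori: fine torus `towerTorus Lc (fine Lc M) m′` (the wrapper's
`towerTorus Lc (fine Lc (Mc B)) (n+1)` at `m′ = n+1 = j`, `M = Mc B`), slot torus `towerTorus Lc M m′` (its `Ma (n+1)`, `hMa` = PART 16 `towerTorus_fine_apply_eq`). -/
theorem tsum_curvAdj_curv_colH_AN_translate_tower (M : Fin (3 + 1) → ℕ) [∀ i, NeZero (M i)] (m' : ℕ) (μ κ : Fin (3 + 1)) (y s : Site (3 + 1)) :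
    (∑' n : Site (3 + 1), curvAdj (curv (colH (AN R j) (Lc ^ (j + 1)) μ y)) κ (translate (towerTorus Lc (fine Lc M) m') s n))
      = -((Lc : ℝ) ^ (3 + 1)) ^ (j + 1) * ∑ κ₁ : Fin (3 + 1), ∑' s₁ : Site (3 + 1),
          (∑' n : Site (3 + 1), ∑ ν : Fin (3 + 1), ∑' w : Site (3 + 1),
              (∑ κ' : Fin (3 + 1), ∑' u : Site (3 + 1),
                  AN R j u (((Lc ^ (j + 1) : ℕ) : ℤ) • y) (Sum.inl κ') (Sum.inr μ) * lamCoeffOf (KInv (N := Lc ^ (j + 1)) (d := 3)) (Lc ^ (j + 1)) ν w κ' u)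
                * compLinKer (fun _ => symLinKerAt (toSite R.r) Lc) Lc j (κ₁, translate (towerTorus Lc M m') s₁ n) (ν, w))
            * symLinKerAt (toSite R.r) Lc κ₁ s₁ (κ, s) :=
  tsum_curvAdj_curv_colH_AN_translate R j (towerTorus Lc M m') (towerTorus Lc (fine Lc M) m') (towerTorus_fine_apply_eq M m')
    (fun i => one_le_of_neZero (towerTorus Lc M m' i)) μ κ y s

end Summit.QuantumFields.BalabanUV.Beta.NVertexColumnK1RowPeriodised

end
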